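import Summits.QuantumFields.YangMills.Theorems.UnitScaleTiltFluctuationComparisonRegPrGlobalSlackKernelLegOnChiV4
import Summits.QuantumFields.YangMills.Theorems.UnitScaleTiltFluctuationComparisonRegPrGlobalSlackCanonicalOnChiChiCV4
import HarnessLib

/-!
# `UnitScaleTiltFluctuationComparisonRegPrGlobalSlackKernelLegOnChiCV4` — THE v4 TWIN (★★OWNER RULING g26-№14 (F-2b); P22b trunk 9, width seat ym-ust-20520-w2 g4; skeleton v5kD, stub `stub_smallBlocksSlackOnChiAllChiV4`) of
# `…KernelLegOnChiC` — STUB (i*)χ OF v5kC IN PRINT'S LEG CURRENCY WITH NO LETTER ON THE RECORD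
# (crux `FluctuationComparisonRegPrIntL`, stmt-QuantumFields-20520, skeleton v5kC, STUB (i*)χ `stub_smallBlocksSlackOnChiAllChiV4`; width-lever lane B, seat ym-ust-19935-r1 g4)

`…KernelLegOnChi` (p577547) reads (i*)χ BY NAME from the On-χ leg rows `K1aLegRowsGOnChiChiV4`/`K1aLegRowsROnChiChiV4`, which carry the On-producer's letter `L ≤ M₁`; with the count-form
On-producer (`…LocalToGlobalOnCount`, p577706) and the letter-free chart rows `K1aChartRowsOnChiCChiV4` (`…CanonicalOnChiChiC`, p577926) the letter goes here too:
**`K1aLegRowsGOnChiCChiV4`** / **`K1aLegRowsROnChiCChiV4`** (= the `…OnChiChi` schemas minus `L ≤ M₁`), `k1aChartRowsOnChiCChiV4_of_legRowsGOnChiCChiV4`, `k1aLegRowsGOnChiCChiV4_of_RV4`,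
**`smallBlocksSlackOnChiAllChiV4_of_k1aLegRowsGOnChiCChiV4/ROnChiCChi : … → ⟨(i*)χ TEXT VERBATIM⟩**.  This completes the matrix {chart, leg currency} × {3⁗χ, (i*)χ} with NO letter on the
constants record: 3⁗χ ⇐ `K1aChartRowsKChi` | `K1aLegRowsRChiV4`; (i*)χ ⇐ `K1aChartRowsOnChiKChi` | `K1aLegRowsROnChiCChiV4` (rates `κ′ < κ₁` are suppliers' choices, not letters).
Hypothesis schemas only; nothing of [Balaban1985UV3]/[King1986] is asserted; no numerics; registry untouched (`--supports stmt-QuantumFields-20520`).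

References: T. Bałaban, CMP 102 (1985) 255–275 [Balaban1985UV3] ((43)–(47) pp.266–267, (57) p.270); CMP 109 (1987) 249–301 [Balaban1987RG1] ((0.26) p.257); C. King, CMP 102 (1986)
649–677 [King1986] (Thm 3.4 (3.9) p.656, Prop. 3.6 (3.56) p.662, Prop. 3.9 (3.71) p.664).
-/

set_option autoImplicit false

noncomputable section

open scoped BigOperators
open Literature.MathematicalPhysics.QuantumFieldTheory.Balaban1983to89
open Literature.MathematicalPhysics.QuantumFieldTheory.Balaban1983to89.T3ContinuumYM3Torus
open Literature.MathematicalPhysics.QuantumFieldTheory.Balaban1983to89.T3UnitScaleTilt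
open Literature.MathematicalPhysics.QuantumFieldTheory.Balaban1983to89.T3LevelShift
open Literature.MathematicalPhysics.QuantumFieldTheory.Balaban1983to89.T3AlphaInputsAC
open Literature.MathematicalPhysics.QuantumFieldTheory.Balaban1983to89.T3AlphaPolymerSocket
open Literature.MathematicalPhysics.QuantumFieldTheory.Balaban1983to89.T3AlphaInputsACTwoRun
open Literature.MathematicalPhysics.QuantumFieldTheory.Balaban1983to89.T3AlphaInputsACTwoRunLevel
open Literature.MathematicalPhysics.QuantumFieldTheory.Balaban1983to89.B12TreeDecay (kappa₀ kappa₀_nonneg)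
open Summit.QuantumFields.Balaban3D.Carriers
open Summit.QuantumFields.Balaban3D.Proofs.Primitives
open Summit.QuantumFields.Balaban3D.Proofs.GroupModelLieC (lieC)
open Summit.QuantumFields.YangMills.Theorems
open Summit.QuantumFields.YangMills.Theorems.GlobalSlackKernelMatching
open Summit.QuantumFields.YangMills.Theorems.GlobalSlackKernelMatchingOn
open Summit.QuantumFields.YangMills.Theorems.GlobalSlackCanonicalPolymers
open Summit.QuantumFields.YangMills.Theorems.GlobalSlackCanonicalOnChi

namespace Summit.QuantumFields.YangMills.Theorems.GlobalSlackKernelLeg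

/-! ## §1 The On-χ leg rows WITHOUT the `L ≤ M₁` letter, and the registered stub (i*)χ -/

variable {F : T3Family} {𝔠 : AlphaConsts F.L (suGroupModel 2).N} {γ : ℝ} {hγ : 0 < γ} {hγ1 : γ ≤ (min 𝔠.gamma0 1) ^ 2}

/-- **THE K1a LEG ROWS AT THE χ-RECORD, GEOMETRY DISCHARGED, THE RESIDUAL/CONFIGURATION ROWS ON χ-GOOD DATA** (hypothesis schema, never asserted; = `K1aLegRowsGOnChiChiV4` minus the letter `L ≤ M₁`): `K1aLegRowsGChiV4` with ONE
change — for every regularity threshold `0 < ε₀ ≤ a₀` the rows `RemainderSmallΦ`, (44) `CfgDistΦ`, `CfgDistCauchyΦ` are asked only at window data that are χ-good with margin `μ`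
for BOTH runs (`PrintChi.ChiGood F γ b₀ p₀ ε₀ μ`), the chart carriers being allowed to depend on `ε₀`; the configuration-free rows `TaylorSplitΦ (canonPTRows (toCore ∘ p))`, K1a
`FlatKernelLegCauchyΦ`, (43) `KernelLegPointwiseΦ` at the canonical leg distance `canonLegDist F` are VERBATIM; NO letter on `M₁` (count-form On-producer).
[cite: Balaban1985UV3, (43)-(47) pp.266-267, (57) p.270; King1986, Prop. 3.6 (3.56) p.662, Prop. 3.9 (3.71) p.664] -/
def K1aLegRowsGOnChiCChiV4 (L : ℕ) (μ : ℝ) (𝔠 : AlphaConsts L (suGroupModel 2).N) (a₀ a₁ a : ℝ) : Prop :=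
  ∃ (κ' κ₁ C A C_R C_s C_B γB : ℝ), 0 < κ' ∧ κ' < κ₁ ∧ 0 ≤ C ∧ 0 ≤ A ∧ 0 ≤ C_R ∧ 0 ≤ C_s ∧ 0 ≤ C_B ∧ 0 < γB ∧
    ∀ (F : T3Family) (γ : ℝ) (hF : F.L = L) (hγ : 0 < γ), γ ≤ γB → ∀ (hγ1 : γ ≤ (min (hF ▸ 𝔠).gamma0 1) ^ 2),
      AlphaInputsT3AC.OfV4ChiAt F (hF ▸ 𝔠) a₀ a₁ →
        ∃ (p : ∀ K, AlphaInputsT3AC.PkgAtV4Chi F (hF ▸ 𝔠) γ hγ hγ1 K), (∀ K, (p K).a₀ = a₀ ∧ (p K).a₁ = a₁) ∧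
          ∀ ε₀ : ℝ, 0 < ε₀ → ε₀ ≤ a₀ →
          ∃ (Φ : ChartFam ↥(lieC (suGroupModel 2)) F) (e : VacFam F) (B : CfgFam ↥(lieC (suGroupModel 2)) F) (R : RemFam F),
            TaylorSplitΦ (canonPTRows fun K => (p K).toRows) Φ e B R ∧
            FlatKernelLegCauchyΦ (AlphaInputsT3AC.dataOfV4chi p (canonPolymerRows fun K => (p K).toRows)) Φ (canonLegDist F) κ' (hF ▸ 𝔠).κ a C ∧
            KernelLegPointwiseΦ (AlphaInputsT3AC.dataOfV4chi p (canonPolymerRows fun K => (p K).toRows)) Φ (canonLegDist F) κ₁ (hF ▸ 𝔠).κ A ∧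
            RemainderSmallΦOn (fun K n h V => PrintChi.ChiGood F γ (hF ▸ 𝔠).b₀ (hF ▸ 𝔠).p₀ ε₀ μ (n := n) (K := K) h V)
              (AlphaInputsT3AC.dataOfV4chi p (canonPolymerRows fun K => (p K).toRows)) R (hF ▸ 𝔠).b₀ (hF ▸ 𝔠).p₀ (hF ▸ 𝔠).κ C_R ∧
            CfgDistΦOn (fun K n h V => PrintChi.ChiGood F γ (hF ▸ 𝔠).b₀ (hF ▸ 𝔠).p₀ ε₀ μ (n := n) (K := K) h V)
              (AlphaInputsT3AC.dataOfV4chi p (canonPolymerRows fun K => (p K).toRows)) B (canonLegDist F) (hF ▸ 𝔠).b₀ (hF ▸ 𝔠).p₀ C_s ∧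
            CfgDistCauchyΦOn (fun K n h V => PrintChi.ChiGood F γ (hF ▸ 𝔠).b₀ (hF ▸ 𝔠).p₀ ε₀ μ (n := n) (K := K) h V)
              (AlphaInputsT3AC.dataOfV4chi p (canonPolymerRows fun K => (p K).toRows)) B (canonLegDist F) (hF ▸ 𝔠).b₀ (hF ▸ 𝔠).p₀ a C_B

/-- **THE On-χ LEG ROWS GIVE THE On-χ CHART ROWS at `κ := 𝔠.κ − ½`** through the rescaled pair `(Φ∘D_w, D_w⁻¹B)` for each `ε₀` (`S := max 1 (legSumConst L 𝔠 (κ₁ − κ′))` by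
`legSummableT_canonRows`, `C_E := A·S⁶·12⁶`, `C_s`, `C_B` times `1 + κ′⁻¹`) — lane A's `k1aChartRowsC_of_legRowsT ∘ k1aLegRowsT_of_G` at the χ-datum with the three On rows
transferred by §2. [cite: Balaban1985UV3, (43)-(45) pp.266-267, (47) p.267; Balaban1987RG1, (0.26) p.257] -/
theorem k1aChartRowsOnChiCChiV4_of_legRowsGOnChiCChiV4 {L : ℕ} {μ : ℝ} {𝔠 : AlphaConsts L (suGroupModel 2).N} {a₀ a₁ a : ℝ} (h : K1aLegRowsGOnChiCChiV4 L μ 𝔠 a₀ a₁ a) :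
    K1aChartRowsOnChiCChiV4 L μ 𝔠 a₀ a₁ a := by
  obtain ⟨κ', κ₁, C, A, C_R, C_s, C_B, γB, hκ', hκ1, hC, hA, hCR, hCs, hCB, hγB, hall⟩ := h
  have hk1 : 0 ≤ 1 + κ'⁻¹ := by positivity
  have hκhalf : kappa₀ (4 * 2 ^ 3) (2 * 3) ≤ 𝔠.κ - 1 / 2 ∧ 0 < 𝔠.κ - 1 / 2 := by
    have hge := 𝔠.kappa_ge
    have h0 : 0 ≤ kappa₀ (4 * 2 ^ 3) (2 * 3) := kappa₀_nonneg (by norm_num) _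
    set k := kappa₀ (4 * 2 ^ 3) (2 * 3) with hk
    constructor <;> linarith
  set S : ℝ := max 1 (legSumConst L 𝔠 (κ₁ - κ')) with hSdef
  have hS : 1 ≤ S := le_max_left _ _
  set C_E : ℝ := A * S ^ 6 * (6 / (1 / 2 : ℝ)) ^ 6 with hCE
  have hCE0 : 0 ≤ C_E := by rw [hCE]; have := zero_le_one.trans hS; positivity
  refine ⟨𝔠.κ - 1 / 2, C, C_E, C_R, C_s * (1 + κ'⁻¹), C_B * (1 + κ'⁻¹), γB, hκhalf.2, by linarith, hκhalf.1, hC, hCE0, hCR,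
    mul_nonneg hCs hk1, mul_nonneg hCB hk1, hγB, fun F γ hF hγ hγle hγ1 hOf => ?_⟩
  subst hF
  obtain ⟨p, hp, hrows⟩ := hall F γ rfl hγ hγle hγ1 hOf
  refine ⟨p, hp, fun ε₀ hε hεa => ?_⟩
  obtain ⟨Φ, e, B, R, hT, hK, hP, hR, hSz, hBC⟩ := hrows ε₀ hε hεa
  have hL : 1 ≤ F.L := F.hL.2.le
  have hγ1' : γ ≤ 1 := hγ1.trans (sq_min_one_le _ 𝔠.gamma0_pos)
  have hTl : ∀ K i Y, 0 ≤ (AlphaInputsT3AC.dataOfV4chi p (canonPolymerRows fun K => (p K).toRows)).treeLen K i Y :=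
    fun K i Y => canonTreeLenRows_nonneg (fun K => (p K).toRows) K i Y
  have hθ : ∀ n, 0 ≤ θBal F.L γ 𝔠.b₀ 𝔠.p₀ n := fun n => (T3MinimiserStabilityReduction.θBal_pos hL hγ hγ1' 𝔠.b₀_pos 𝔠.p₀ n).le
  have hn := canonLegDist_nonneg F
  have hm := canonLegDist_matched F
  have hsum : LegSummableT (AlphaInputsT3AC.dataOfV4chi p (canonPolymerRows fun K => (p K).toRows)) (canonLegDist F) (κ₁ - κ') S :=
    legSummableT_mono_S hTl (le_max_right _ _) (legSummableT_canonRows (fun K => (p K).toRows) (by linarith))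
  have hE : KernelLegΦ (AlphaInputsT3AC.dataOfV4chi p (canonPolymerRows fun K => (p K).toRows)) Φ (canonLegDist F) κ' (𝔠.κ - 1 / 2) C_E :=
    kernelLegΦ_of_pointwise_T hn hTl (by linarith) hA hS (by norm_num) (by norm_num) hP hsum
  have hK' := flatKernelLegCauchyΦ_mono hTl (show 𝔠.κ - 1 / 2 ≤ 𝔠.κ by linarith) hC hK
  have hR' := remainderSmallΦOn_mono _ hTl hθ (show 𝔠.κ - 1 / 2 ≤ 𝔠.κ by linarith) hCR hR
  exact ⟨rescaleΦw (canonLegDist F) κ' Φ, e, rescaleBw (canonLegDist F) κ' B, R, taylorSplitΦ_rescaleW (canonLegDist F) κ' hT,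
    flatKernelCauchyΦ_rescaleW hm hK', kernelSizeΦ_rescaleW hE, hR',
    cfgSizeΦOn_rescaleW _ hL hγ hγ1' 𝔠.b₀_pos hn hm hκ' hCs hSz, cfgCauchyΦOn_rescaleW _ hL hγ hγ1' 𝔠.b₀_pos hn hm hκ' hCB hBC⟩

/-- **THE REGISTERED STUB (i*)χ FROM THE LEG ROWS WITH THE THREE CONFIGURATION ROWS ON PRINT'S χ, BY NAME** (`smallBlocksSlackOnChiAllChiV4_of_k1aChartRowsOnChiCChiV4 ∘
k1aChartRowsOnChiCChiV4_of_legRowsGOnChiCChiV4`): if for every odd `1 < L < 7`, every margin `μ ∈ (0,1)`, every constants record and [7]-constants there is `0 < a < 1` with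
`K1aLegRowsGOnChiCChiV4 L μ 𝔠 a₀ a₁ a`, then the text of `stub_smallBlocksSlackOnChiAllChiV4` (skeleton v5kC of stmt-QuantumFields-20520) holds VERBATIM.
[cite: Balaban1985UV3, (43)-(47) pp.266-267, (57) p.270; King1986, Thm 3.4 (3.9) p.656, Prop. 3.6 p.662] -/
theorem smallBlocksSlackOnChiAllChiV4_of_k1aLegRowsGOnChiCChiV4
    (h : ∀ (L : ℕ), Odd L → 1 < L → L < 7 → ∀ (μ : ℝ), 0 < μ → μ < 1 → ∀ (𝔠 : AlphaConsts L (suGroupModel 2).N) (a₀ a₁ : ℝ),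
      0 < a₀ → 0 < a₁ → 𝔠.B₃ * a₁ ≤ a₀ → ∃ a : ℝ, 0 < a ∧ a < 1 ∧ K1aLegRowsGOnChiCChiV4 L μ 𝔠 a₀ a₁ a) :
    ∀ (L : ℕ), Odd L → 1 < L → L < 7 → ∀ (μ : ℝ), 0 < μ → μ < 1 →
      ∀ (𝔠 : Summit.QuantumFields.Balaban3D.Proofs.Primitives.AlphaConsts L (Summit.QuantumFields.Balaban3D.Carriers.suGroupModel 2).N)
        (a₀ a₁ : ℝ), 0 < a₀ → 0 < a₁ → 𝔠.B₃ * a₁ ≤ a₀ →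
        ∃ a : ℝ, 0 < a ∧ ∃ γB : ℝ, 0 < γB ∧ ∀ (F : T3Family) (γ : ℝ) (hF : F.L = L) (hγ : 0 < γ), γ ≤ γB →
          ∀ (hγ1 : γ ≤ (min (hF ▸ 𝔠).gamma0 1) ^ 2),
            Summit.QuantumFields.YangMills.Theorems.AlphaInputsT3AC.OfV4ChiAt F (hF ▸ 𝔠) a₀ a₁ →
            ∃ (p : ∀ K, Summit.QuantumFields.YangMills.Theorems.AlphaInputsT3AC.PkgAtV4Chi F (hF ▸ 𝔠) γ hγ hγ1 K),
              (∀ K, (p K).a₀ = a₀ ∧ (p K).a₁ = a₁) ∧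
              ∃ (π : Summit.QuantumFields.YangMills.Theorems.AlphaInputsT3AC.PolymerT3 F) (σ : ℕ) (C : ℝ), 7 ≤ σ ∧ 0 ≤ C ∧
                ∀ ε₀ : ℝ, 0 < ε₀ → ε₀ ≤ a₀ →
                  Summit.QuantumFields.YangMills.Theorems.PrintChi.GlobalSupRateTSlackOn
                    (fun K n h V => Summit.QuantumFields.YangMills.Theorems.PrintChi.ChiGood F γ (hF ▸ 𝔠).b₀ (hF ▸ 𝔠).p₀ ε₀ μ (n := n) (K := K) h V)
                    (Summit.QuantumFields.YangMills.Theorems.AlphaInputsT3AC.dataOfV4chi p π) (hF ▸ 𝔠).b₀ (hF ▸ 𝔠).p₀ a σ C :=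
  smallBlocksSlackOnChiAllChiV4_of_k1aChartRowsOnChiCChiV4 fun L hLo hL1 hL7 μ hμ0 hμ1 𝔠 a₀ a₁ ha0 ha1 hw => by
    obtain ⟨a, ha, ha1', hc⟩ := h L hLo hL1 hL7 μ hμ0 hμ1 𝔠 a₀ a₁ ha0 ha1 hw
    exact ⟨a, ha, ha1', k1aChartRowsOnChiCChiV4_of_legRowsGOnChiCChiV4 hc⟩

/-- **THE On-χ LEG ROWS OVER `(Φ, e, B)` ONLY** (hypothesis schema, never asserted): `K1aLegRowsGOnChiCChiV4` with the rest ELIMINATED — for each `ε₀` the remainder row is stated for the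
RESIDUAL `residualRemRows (toCore ∘ p) Φ e B` ((M1) to seventh order + the far terms, on χ-good data); plus K1a `FlatKernelLegCauchyΦ`, (43) `KernelLegPointwiseΦ` (full window) and
(44) `CfgDistΦOn`/`CfgDistCauchyΦOn` (on χ) at the canonical leg distance. [cite: Balaban1985UV3, (43)-(44) pp.266-267, (47) p.267, (57) p.270; King1986, Prop. 3.6 (3.56) p.662, Prop. 3.9 (3.71) p.664] -/
def K1aLegRowsROnChiCChiV4 (L : ℕ) (μ : ℝ) (𝔠 : AlphaConsts L (suGroupModel 2).N) (a₀ a₁ a : ℝ) : Prop :=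
  ∃ (κ' κ₁ C A C_R C_s C_B γB : ℝ), 0 < κ' ∧ κ' < κ₁ ∧ 0 ≤ C ∧ 0 ≤ A ∧ 0 ≤ C_R ∧ 0 ≤ C_s ∧ 0 ≤ C_B ∧ 0 < γB ∧
    ∀ (F : T3Family) (γ : ℝ) (hF : F.L = L) (hγ : 0 < γ), γ ≤ γB → ∀ (hγ1 : γ ≤ (min (hF ▸ 𝔠).gamma0 1) ^ 2),
      AlphaInputsT3AC.OfV4ChiAt F (hF ▸ 𝔠) a₀ a₁ →
        ∃ (p : ∀ K, AlphaInputsT3AC.PkgAtV4Chi F (hF ▸ 𝔠) γ hγ hγ1 K), (∀ K, (p K).a₀ = a₀ ∧ (p K).a₁ = a₁) ∧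
          ∀ ε₀ : ℝ, 0 < ε₀ → ε₀ ≤ a₀ →
          ∃ (Φ : ChartFam ↥(lieC (suGroupModel 2)) F) (e : VacFam F) (B : CfgFam ↥(lieC (suGroupModel 2)) F),
            FlatKernelLegCauchyΦ (AlphaInputsT3AC.dataOfV4chi p (canonPolymerRows fun K => (p K).toRows)) Φ (canonLegDist F) κ' (hF ▸ 𝔠).κ a C ∧
            KernelLegPointwiseΦ (AlphaInputsT3AC.dataOfV4chi p (canonPolymerRows fun K => (p K).toRows)) Φ (canonLegDist F) κ₁ (hF ▸ 𝔠).κ A ∧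
            RemainderSmallΦOn (fun K n h V => PrintChi.ChiGood F γ (hF ▸ 𝔠).b₀ (hF ▸ 𝔠).p₀ ε₀ μ (n := n) (K := K) h V)
              (AlphaInputsT3AC.dataOfV4chi p (canonPolymerRows fun K => (p K).toRows)) (residualRemRows (fun K => (p K).toRows) Φ e B)
              (hF ▸ 𝔠).b₀ (hF ▸ 𝔠).p₀ (hF ▸ 𝔠).κ C_R ∧
            CfgDistΦOn (fun K n h V => PrintChi.ChiGood F γ (hF ▸ 𝔠).b₀ (hF ▸ 𝔠).p₀ ε₀ μ (n := n) (K := K) h V)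
              (AlphaInputsT3AC.dataOfV4chi p (canonPolymerRows fun K => (p K).toRows)) B (canonLegDist F) (hF ▸ 𝔠).b₀ (hF ▸ 𝔠).p₀ C_s ∧
            CfgDistCauchyΦOn (fun K n h V => PrintChi.ChiGood F γ (hF ▸ 𝔠).b₀ (hF ▸ 𝔠).p₀ ε₀ μ (n := n) (K := K) h V)
              (AlphaInputsT3AC.dataOfV4chi p (canonPolymerRows fun K => (p K).toRows)) B (canonLegDist F) (hF ▸ 𝔠).b₀ (hF ▸ 𝔠).p₀ a C_B

/-- The five On-χ rows give the six (`R := residualRemRows (toCore ∘ p) Φ e B`, `TaylorSplitΦ` by definition). [cite: Balaban1985UV3, (43) p.266] -/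
theorem k1aLegRowsGOnChiCChiV4_of_RV4 {L : ℕ} {μ : ℝ} {𝔠 : AlphaConsts L (suGroupModel 2).N} {a₀ a₁ a : ℝ} (h : K1aLegRowsROnChiCChiV4 L μ 𝔠 a₀ a₁ a) :
    K1aLegRowsGOnChiCChiV4 L μ 𝔠 a₀ a₁ a := by
  obtain ⟨κ', κ₁, C, A, C_R, C_s, C_B, γB, hκ', hκ1, hC, hA, hCR, hCs, hCB, hγB, hall⟩ := h
  refine ⟨κ', κ₁, C, A, C_R, C_s, C_B, γB, hκ', hκ1, hC, hA, hCR, hCs, hCB, hγB, fun F γ hF hγ hγle hγ1 hOf => ?_⟩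
  obtain ⟨p, hp, hrows⟩ := hall F γ hF hγ hγle hγ1 hOf
  refine ⟨p, hp, fun ε₀ hε hεa => ?_⟩
  obtain ⟨Φ, e, B, hK, hP, hR, hS, hBC⟩ := hrows ε₀ hε hεa
  exact ⟨Φ, e, B, residualRemRows (fun K => (p K).toRows) Φ e B, taylorSplitΦ_residualRows (fun K => (p K).toRows) Φ e B, hK, hP, hR, hS, hBC⟩

/-- **THE REGISTERED STUB (i*)χ FROM FIVE On-χ LEG ROWS OVER `(Φ, e, B)`, BY NAME** (`smallBlocksSlackOnChiAllChiV4_of_k1aLegRowsGOnChiCChiV4 ∘ k1aLegRowsGOnChiCChiV4_of_RV4`).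
[cite: Balaban1985UV3, (43)-(47) pp.266-267, (57) p.270; King1986, Thm 3.4 (3.9) p.656, Prop. 3.6 p.662] -/
theorem smallBlocksSlackOnChiAllChiV4_of_k1aLegRowsROnChiCChiV4
    (h : ∀ (L : ℕ), Odd L → 1 < L → L < 7 → ∀ (μ : ℝ), 0 < μ → μ < 1 → ∀ (𝔠 : AlphaConsts L (suGroupModel 2).N) (a₀ a₁ : ℝ),
      0 < a₀ → 0 < a₁ → 𝔠.B₃ * a₁ ≤ a₀ → ∃ a : ℝ, 0 < a ∧ a < 1 ∧ K1aLegRowsROnChiCChiV4 L μ 𝔠 a₀ a₁ a) :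
    ∀ (L : ℕ), Odd L → 1 < L → L < 7 → ∀ (μ : ℝ), 0 < μ → μ < 1 →
      ∀ (𝔠 : Summit.QuantumFields.Balaban3D.Proofs.Primitives.AlphaConsts L (Summit.QuantumFields.Balaban3D.Carriers.suGroupModel 2).N)
        (a₀ a₁ : ℝ), 0 < a₀ → 0 < a₁ → 𝔠.B₃ * a₁ ≤ a₀ →
        ∃ a : ℝ, 0 < a ∧ ∃ γB : ℝ, 0 < γB ∧ ∀ (F : T3Family) (γ : ℝ) (hF : F.L = L) (hγ : 0 < γ), γ ≤ γB →
          ∀ (hγ1 : γ ≤ (min (hF ▸ 𝔠).gamma0 1) ^ 2),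
            Summit.QuantumFields.YangMills.Theorems.AlphaInputsT3AC.OfV4ChiAt F (hF ▸ 𝔠) a₀ a₁ →
            ∃ (p : ∀ K, Summit.QuantumFields.YangMills.Theorems.AlphaInputsT3AC.PkgAtV4Chi F (hF ▸ 𝔠) γ hγ hγ1 K),
              (∀ K, (p K).a₀ = a₀ ∧ (p K).a₁ = a₁) ∧
              ∃ (π : Summit.QuantumFields.YangMills.Theorems.AlphaInputsT3AC.PolymerT3 F) (σ : ℕ) (C : ℝ), 7 ≤ σ ∧ 0 ≤ C ∧
                ∀ ε₀ : ℝ, 0 < ε₀ → ε₀ ≤ a₀ →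
                  Summit.QuantumFields.YangMills.Theorems.PrintChi.GlobalSupRateTSlackOn
                    (fun K n h V => Summit.QuantumFields.YangMills.Theorems.PrintChi.ChiGood F γ (hF ▸ 𝔠).b₀ (hF ▸ 𝔠).p₀ ε₀ μ (n := n) (K := K) h V)
                    (Summit.QuantumFields.YangMills.Theorems.AlphaInputsT3AC.dataOfV4chi p π) (hF ▸ 𝔠).b₀ (hF ▸ 𝔠).p₀ a σ C :=
  smallBlocksSlackOnChiAllChiV4_of_k1aLegRowsGOnChiCChiV4 fun L hLo hL1 hL7 μ hμ0 hμ1 𝔠 a₀ a₁ ha0 ha1 hw => by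
    obtain ⟨a, ha, ha1', hc⟩ := h L hLo hL1 hL7 μ hμ0 hμ1 𝔠 a₀ a₁ ha0 ha1 hw
    exact ⟨a, ha, ha1', k1aLegRowsGOnChiCChiV4_of_RV4 hc⟩

end Summit.QuantumFields.YangMills.Theorems.GlobalSlackKernelLeg

end
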